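import Literature.MathematicalPhysics.QuantumFieldTheory.ConformalBootstrap3D.PointKernelK34v2Data
import Literature.MathematicalPhysics.QuantumFieldTheory.ConformalBootstrap3D.PointKernelParts

/-!
# K34v2 certificate, kernel part file P70: one-cell head segments 179, 180, 181 in level ranges

The head cells whose kernel evaluation exceeds one `decide` are one-cell segments of `hsegsK34v2`; each is
checked by `PCert.hPartSideOK` (side conditions) and `PCert.hPartOK` per level range `[n_lo, n_lo + count)`
against an integer claim, the claims summing to `≥ 0` (`PointKernel.partsOK`); soundness is
`PCert.hParts_sound` (`PointKernelParts`).  The part files `P1, P2, …` are mutually independent (each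
imports only the data file); the ranges of one cell may span several of them, and the per-cell
conclusions `hparts_i` / `hcell_i` of those cells are assembled in `PointKernelK34v2.lean`.
Estimated kernel time 257 s.
-/

set_option maxRecDepth 100000
set_option maxHeartbeats 0

namespace Literature.MathematicalPhysics.QuantumFieldTheory.ConformalBootstrap3D.PointKernelK34v2

open Literature.MathematicalPhysics.QuantumFieldTheory.ConformalBootstrap3D.PointKernel

/-- levels `[31, 44)` of segment 179: partial lower sum `≥` claim. [folklore] -/
theorem part_179_1 : certK34v2.hPartOK (PCert.segAt hsegsK34v2 179) JHK34v2 31 13 (15515218195539103852069852524557315552) = true := by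
  decide +kernel

/-- levels `[44, 49)` of segment 179: partial lower sum `≥` claim. [folklore] -/
theorem part_179_2 : certK34v2.hPartOK (PCert.segAt hsegsK34v2 179) JHK34v2 44 5 (1193306354212050042123985164141669802) = true := by
  decide +kernel

/-- one-cell segment 180 (row 6, cell `[453/64, 907/128]`, chord, `n_F = 40`,
2 level ranges): side conditions. [folklore] -/
theorem pside_180 : certK34v2.hPartSideOK (PCert.segAt hsegsK34v2 180) JHK34v2 = true := by
  decide +kernel

/-- its level ranges `(n_lo, count, claim)`. [folklore] -/
def parts_180 : List (ℕ × ℕ × ℤ) := [(0, 32, -11894053134091197099493800260586532399), (32, 9, 11894053134091197099493800260586532400)]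

/-- the ranges tile `[0, n_F]` and the claims sum to `≥ 0`. [folklore] -/
theorem pcov_180 : PointKernel.partsOK 40 parts_180 = true := by
  decide +kernel

/-- levels `[0, 32)` of segment 180: partial lower sum `≥` claim. [folklore] -/
theorem part_180_0 : certK34v2.hPartOK (PCert.segAt hsegsK34v2 180) JHK34v2 0 32 (-11894053134091197099493800260586532399) = true := by
  decide +kernel

/-- levels `[32, 41)` of segment 180: partial lower sum `≥` claim. [folklore] -/
theorem part_180_1 : certK34v2.hPartOK (PCert.segAt hsegsK34v2 180) JHK34v2 32 9 (11894053134091197099493800260586532400) = true := by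
  decide +kernel

/-- one-cell segment 181 (row 6, cell `[907/128, 227/32]`, chord, `n_F = 40`,
2 level ranges): side conditions. [folklore] -/
theorem pside_181 : certK34v2.hPartSideOK (PCert.segAt hsegsK34v2 181) JHK34v2 = true := by
  decide +kernel

/-- its level ranges `(n_lo, count, claim)`. [folklore] -/
def parts_181 : List (ℕ × ℕ × ℤ) := [(0, 32, -10866729570342870551387319443506232836), (32, 9, 10866729570342870551387319443506232836)]

/-- the ranges tile `[0, n_F]` and the claims sum to `≥ 0`. [folklore] -/
theorem pcov_181 : PointKernel.partsOK 40 parts_181 = true := by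
  decide +kernel

/-- levels `[0, 32)` of segment 181: partial lower sum `≥` claim. [folklore] -/
theorem part_181_0 : certK34v2.hPartOK (PCert.segAt hsegsK34v2 181) JHK34v2 0 32 (-10866729570342870551387319443506232836) = true := by
  decide +kernel

end Literature.MathematicalPhysics.QuantumFieldTheory.ConformalBootstrap3D.PointKernelK34v2
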